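import Summits.QuantumFields.YangMills.Theorems.SqueezedSkewnessTorusKLWindow
import Summits.QuantumFields.YangMills.Theorems.SqueezedSkewnessTorusKLMixtureLemmas
import HarnessLib

/-!
# Route `SqueezedSkewness`, crux `SpectralIdentificationL` (stmt-QuantumFields-22796), stub `stub_osData` — OS-DATA layer (O5a):
# THE PERIOD-UNIFORM WINDOW OF A COMPACT-HEIGHT TEST FUNCTION

For the thermodynamic limit `T_k → ∞` the coefficient function `x ↦ f (s • posE_T x)` of the route's smeared field `B` must be
book-kept on a `T`-INDEPENDENT index set (layer (K5) `…TorusKLWindow` of g16 used the `T`-dependent set `Fin T × (spatial torus)`):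
here it is the finite window `Fin (h+1) × FinSpatialSite S S S`, `h = ⌊H/s⌋`, embedded into the torus of any period `T ≥ h + 1` by
`(t, q) ↦ q.toSite (Fin.castLE _ t)` and into `ℤ⁴` by `(t, q) ↦ (t, cc q)` (centred spatial coordinates).

* `two_floor_add_three_le` — `2H + 3s ≤ sT ⇒ 2⌊H/s⌋ + 3 ≤ T`;
* `sum_torus_window` — `Σ_{x ∈ torus_T} f(s·posE_T x) F x = Σ_{(t,q) ∈ window} f(s·(t, cc q)) F (q.toSite t)` for EVERY `F` and every
  admissible period (`2H + 3s ≤ sT`);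
* `tsum_lattice_window` — `Σ'_{x ∈ ℤ⁴} f(s·x) • V x = Σ_{(t,q) ∈ window} f(s·(t, cc q)) • V (t, cc q)`;
* `one_le_of_coef_ne_zero` — a window point with non-zero coefficient has time `t ≥ 1`;
* `cov_window_expansion` — pure algebra: the reflection covariance `E[(B∘θ)B] − E[B∘θ]E[B]` of `B = Σ_x coef x · A x` expands over the
  window into site-resolved two- and one-point functions (finite sums commute with the integrals).

Seat `ym-line-fcl-p3` g17 (cell ym-idea-1; free hands); route-independent imports; `[folklore]`; nothing about a summit, NT or the mass gap.
References: I. Montvay, G. Münster, *Quantum Fields on a Lattice* (1994) §3.2.6 [cite: MontvayMunster1994, §3.2.6].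
-/

set_option autoImplicit false

noncomputable section

open MeasureTheory Function
open scoped BigOperators
open Literature.MathematicalPhysics.QuantumFieldTheory Literature.MathematicalPhysics.QuantumLattice

namespace Summit.QuantumFields.YangMills.Theorems.TorusKL.OSData

/-! ## §1 Arithmetic of the window -/

/-- `2H + 3s ≤ sT ⇒ 2⌊H/s⌋ + 3 ≤ T` (for `H ≥ 0`). [folklore] -/
theorem two_floor_add_three_le {s H : ℝ} {T : ℕ} (hs : 0 < s) (hHT : 2 * H + 3 * s ≤ s * T) (hH : 0 ≤ H) :
    2 * ⌊H / s⌋₊ + 3 ≤ T := by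
  have hHs : 0 ≤ H / s := div_nonneg hH hs.le
  have e1 : (⌊H / s⌋₊ : ℝ) ≤ H / s := Nat.floor_le hHs
  have e2 : 2 * (H / s) + 3 ≤ (T : ℝ) := by
    rw [← sub_nonneg] at hHT ⊢
    have e4 : (T : ℝ) - (2 * (H / s) + 3) = (s * (T : ℝ) - (2 * H + 3 * s)) / s := by field_simp
    rw [e4]; exact div_nonneg hHT hs.le
  have e3 : (2 * ⌊H / s⌋₊ + 3 : ℝ) ≤ T := by linarith
  exact_mod_cast e3

/-- Some admissible period exists: `2H + 3s ≤ s (2⌊H/s⌋ + 5)`. [folklore] -/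
theorem exists_admissible_period {s H : ℝ} (hs : 0 < s) : 2 * H + 3 * s ≤ s * ((2 * ⌊H / s⌋₊ + 5 : ℕ) : ℝ) := by
  have h1 : H / s < ⌊H / s⌋₊ + 1 := Nat.lt_floor_add_one (H / s)
  have h2 : H < s * (⌊H / s⌋₊ + 1) := by
    have := mul_lt_mul_of_pos_left h1 hs
    rwa [mul_div_cancel₀ _ hs.ne'] at this
  push_cast
  nlinarith

/-! ## §2 The torus site sum over the window -/

/-- **Torus sums of the smeared field live on the window.**  For an admissible period (`2H + 3s ≤ sT`) and EVERY `F`,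
`Σ_{x ∈ torus_T} f(s·posE_T x) F x = Σ_{(t,q)} f(s·(t, cc q)) F (q.toSite t)` over `Fin (⌊H/s⌋+1) × FinSpatialSite S S S`.
[cite: MontvayMunster1994, §3.2.6] -/
theorem sum_torus_window {L T : ℕ} {s H : ℝ} (hs : 0 < s) (hHT : 2 * H + 3 * s ≤ s * T) {f : EuclideanSpace ℝ (Fin 4) → ℝ}
    (hf1 : tsupport f ⊆ {y | 0 < y 0 ∧ y 0 ≤ H}) (hf2 : tsupport f ⊆ {y | ∀ i : Fin 3, |y i.succ| < s * (L + 1 / 2)})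
    (cc : (n : ℕ) → Fin n → ℤ) (hcc : cc = fun (n : ℕ) (i : Fin n) => if 2 * i.val < n then (i.val : ℤ) else (i.val : ℤ) - n)
    {h : ℕ} (hh : h = ⌊H / s⌋₊) (hT : h + 1 ≤ T) (F : FinTorusSite (2 * L + 1) (2 * L + 1) (2 * L + 1) T → ℝ) :
    ∑ x : FinTorusSite (2 * L + 1) (2 * L + 1) (2 * L + 1) T,
        f (s • siteToE (d := 4) ![cc T x.2.2.2, cc (2 * L + 1) x.1, cc (2 * L + 1) x.2.1, cc (2 * L + 1) x.2.2.1]) * F x =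
      ∑ tq : Fin (h + 1) × FinSpatialSite (2 * L + 1) (2 * L + 1) (2 * L + 1),
        f (s • siteToE (d := 4) ![((tq.1 : ℕ) : ℤ), cc (2 * L + 1) tq.2.1, cc (2 * L + 1) tq.2.2.1, cc (2 * L + 1) tq.2.2.2]) *
          F (tq.2.toSite (Fin.castLE hT tq.1)) := by
  classical
  have h2T : 2 * h < T := by
    by_cases hH : 0 ≤ H
    · have h23 := two_floor_add_three_le hs hHT hH
      rw [← hh] at h23; omega
    · have e0 : h = 0 := by
        rw [hh]; exact Nat.floor_of_nonpos (div_neg_of_neg_of_pos (not_le.1 hH) hs).le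
      omega
  rw [Window.sum_finTorusSite_eq_sum_toSite]
  -- the time sum lives on `t < h + 1`
  have hzero : ∀ t : Fin T, t ∉ Set.range (Fin.castLE hT) →
      (∑ q : FinSpatialSite (2 * L + 1) (2 * L + 1) (2 * L + 1),
        f (s • siteToE (d := 4) ![cc T (q.toSite t).2.2.2, cc (2 * L + 1) (q.toSite t).1, cc (2 * L + 1) (q.toSite t).2.1,
          cc (2 * L + 1) (q.toSite t).2.2.1]) * F (q.toSite t)) = 0 := by
    intro t ht
    have htv : h + 1 ≤ (t : ℕ) := by
      by_contra hlt
      exact ht ⟨⟨t, by omega⟩, Fin.ext rfl⟩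
    refine Finset.sum_eq_zero fun q _ => ?_
    have hf0 : f (s • siteToE (d := 4) ![cc T (q.toSite t).2.2.2, cc (2 * L + 1) (q.toSite t).1, cc (2 * L + 1) (q.toSite t).2.1,
        cc (2 * L + 1) (q.toSite t).2.2.1]) = 0 := by
      by_contra hne
      obtain ⟨h1, h2, -, -⟩ := Window.window_of_ne_zero hs hHT hf1 hf2 _ hne
      simp only [Matrix.cons_val_zero, FinSpatialSite.toSite, hcc] at h1 h2
      by_cases h2t : 2 * t.val < T
      · simp only [h2t, if_true, Int.cast_natCast] at h1 h2
        have h3 : (t : ℕ) ≤ ⌊H / s⌋₊ := Nat.le_floor h2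
        omega
      · simp only [h2t, if_false] at h1; omega
    rw [hf0, zero_mul]
  rw [← tsum_fintype (L := SummationFilter.unconditional _), Window.tsum_eq_sum_of_support (Fin.castLE hT)
    (Fin.castLE_injective hT) _ hzero, Fintype.sum_prod_type]
  refine Finset.sum_congr rfl fun t _ => Finset.sum_congr rfl fun q _ => ?_
  have hct : cc T (Fin.castLE hT t) = ((t : ℕ) : ℤ) := by
    rw [hcc]; simp only [Fin.val_castLE]; rw [if_pos (by omega)]
  simp only [FinSpatialSite.toSite, hct]

/-- **A window point with a non-zero coefficient has time `t ≥ 1`** (and `f(s·(0, ·)) = 0`). [folklore] -/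
theorem one_le_of_coef_ne_zero {L : ℕ} {s H : ℝ} (hs : 0 < s) {f : EuclideanSpace ℝ (Fin 4) → ℝ}
    (hf1 : tsupport f ⊆ {y | 0 < y 0 ∧ y 0 ≤ H}) (hf2 : tsupport f ⊆ {y | ∀ i : Fin 3, |y i.succ| < s * (L + 1 / 2)})
    {t : ℕ} {a b c : ℤ} (hne : f (s • siteToE (d := 4) ![(t : ℤ), a, b, c]) ≠ 0) : 1 ≤ t := by
  obtain ⟨h1, -, -, -⟩ := Window.window_of_ne_zero (L := L) hs (exists_admissible_period (H := H) hs) hf1 hf2 _ hne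
  simp only [Matrix.cons_val_zero] at h1
  omega

/-! ## §3 The lattice sum over the window -/

/-- **Lattice sums of the test function live on the window**: `Σ'_{x ∈ ℤ⁴} f(s·x) • V x = Σ_{(t,q)} f(s·(t, cc q)) • V (t, cc q)`.
[cite: MontvayMunster1994, §3.2.6] -/
theorem tsum_lattice_window {L : ℕ} {s H : ℝ} (hs : 0 < s) {f : EuclideanSpace ℝ (Fin 4) → ℝ}
    (hf1 : tsupport f ⊆ {y | 0 < y 0 ∧ y 0 ≤ H}) (hf2 : tsupport f ⊆ {y | ∀ i : Fin 3, |y i.succ| < s * (L + 1 / 2)})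
    (cc : (n : ℕ) → Fin n → ℤ) (hcc : cc = fun (n : ℕ) (i : Fin n) => if 2 * i.val < n then (i.val : ℤ) else (i.val : ℤ) - n)
    {h : ℕ} (hh : h = ⌊H / s⌋₊) {E : Type*} [AddCommGroup E] [Module ℂ E] [TopologicalSpace E] (V : (Fin 4 → ℤ) → E) :
    ∑' x : Fin 4 → ℤ, ((f (s • siteToE (d := 4) x) : ℝ) : ℂ) • V x =
      ∑ tq : Fin (h + 1) × FinSpatialSite (2 * L + 1) (2 * L + 1) (2 * L + 1),
        ((f (s • siteToE (d := 4) ![((tq.1 : ℕ) : ℤ), cc (2 * L + 1) tq.2.1, cc (2 * L + 1) tq.2.2.1, cc (2 * L + 1) tq.2.2.2]) : ℝ) : ℂ) •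
          V ![((tq.1 : ℕ) : ℤ), cc (2 * L + 1) tq.2.1, cc (2 * L + 1) tq.2.2.1, cc (2 * L + 1) tq.2.2.2] := by
  classical
  -- the window map is injective
  have hinj : Injective fun tq : Fin (h + 1) × FinSpatialSite (2 * L + 1) (2 * L + 1) (2 * L + 1) =>
      (![((tq.1 : ℕ) : ℤ), cc (2 * L + 1) tq.2.1, cc (2 * L + 1) tq.2.2.1, cc (2 * L + 1) tq.2.2.2] : Fin 4 → ℤ) := by
    rintro ⟨t, a, b, c⟩ ⟨t', a', b', c'⟩ hEq
    have h0 : ((t : ℕ) : ℤ) = ((t' : ℕ) : ℤ) := by simpa using congrFun hEq 0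
    have h1 : cc (2 * L + 1) a = cc (2 * L + 1) a' := by simpa using congrFun hEq 1
    have h2 : cc (2 * L + 1) b = cc (2 * L + 1) b' := by simpa using congrFun hEq 2
    have h3 : cc (2 * L + 1) c = cc (2 * L + 1) c' := by simpa using congrFun hEq 3
    subst hcc
    simp only [Prod.mk.injEq]
    exact ⟨Fin.ext (by exact_mod_cast h0), Window.centered_injective _ h1, Window.centered_injective _ h2,
      Window.centered_injective _ h3⟩
  -- off the window the coefficient vanishes
  have h0f : ∀ x : Fin 4 → ℤ, x ∉ Set.range (fun tq : Fin (h + 1) × FinSpatialSite (2 * L + 1) (2 * L + 1) (2 * L + 1) =>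
      (![((tq.1 : ℕ) : ℤ), cc (2 * L + 1) tq.2.1, cc (2 * L + 1) tq.2.2.1, cc (2 * L + 1) tq.2.2.2] : Fin 4 → ℤ)) →
      ((f (s • siteToE (d := 4) x) : ℝ) : ℂ) • V x = 0 := by
    intro x hx
    by_cases hfx : f (s • siteToE (d := 4) x) = 0
    · rw [hfx, Complex.ofReal_zero, zero_smul]
    exfalso
    obtain ⟨h1, h2, -, h4⟩ := Window.window_of_ne_zero (L := L) hs (exists_admissible_period (H := H) hs) hf1 hf2 x hfx
    apply hx
    have ht : (x 0).toNat < h + 1 := by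
      have e1 : (((x 0).toNat : ℕ) : ℝ) ≤ H / s := by
        have e2 : (((x 0).toNat : ℤ) : ℝ) = (x 0 : ℝ) := by rw [Int.toNat_of_nonneg (by omega)]
        have e3 : (((x 0).toNat : ℕ) : ℝ) = (((x 0).toNat : ℤ) : ℝ) := by norm_cast
        rw [e3, e2]; exact h2
      have e4 : (x 0).toNat ≤ ⌊H / s⌋₊ := Nat.le_floor e1
      omega
    obtain ⟨a, ha⟩ := Window.exists_centered_eq (2 * L + 1) (x 1) (by have := (h4 0).1; simp at this ⊢; omega)
      (by have := (h4 0).2; simp at this ⊢; omega)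
    obtain ⟨b, hb⟩ := Window.exists_centered_eq (2 * L + 1) (x 2) (by have := (h4 1).1; simp at this ⊢; omega)
      (by have := (h4 1).2; simp at this ⊢; omega)
    obtain ⟨c, hc⟩ := Window.exists_centered_eq (2 * L + 1) (x 3) (by have := (h4 2).1; simp at this ⊢; omega)
      (by have := (h4 2).2; simp at this ⊢; omega)
    refine ⟨(⟨(x 0).toNat, ht⟩, (a, b, c)), funext fun i => ?_⟩
    subst hcc
    fin_cases i
    · simp; omega
    · simpa using ha
    · simpa using hb
    · simpa using hc
  exact Window.tsum_eq_sum_of_support _ hinj _ h0f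

/-! ## §4 The reflection covariance expanded over the window (pure algebra) -/

/-- **The reflection covariance of a windowed field, site-resolved.**  If `Σ_x coef x · F x = Σ_i cf i · F (emb i)` for every `F`
(the window identity), then for site observables `Af x`, a configuration map `rf` and a weight `wt` (all products integrable):
`E[(B∘rf)·B] − E[B∘rf]·E[B] = Σ_i Σ_j cf i cf j E[Af (emb j) · Af (emb i)∘rf] − (Σ_i cf i E[Af (emb i)∘rf]) (Σ_j cf j E[Af (emb j)])`,
`E[Φ] = (∫ Φ wt)/Z`, `B = Σ_x coef x · Af x`. [cite: MontvayMunster1994, §3.2.6] -/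
theorem cov_window_expansion {Ω : Type*} [MeasurableSpace Ω] (μ : Measure Ω) {ι X : Type*} [Fintype ι] [Fintype X]
    (coef : X → ℝ) (emb : ι → X) (cf : ι → ℝ) (hwin : ∀ F : X → ℝ, ∑ x, coef x * F x = ∑ i, cf i * F (emb i))
    (Af : X → Ω → ℝ) (rf : Ω → Ω) (wt : Ω → ℝ) (Z : ℝ)
    (hint2 : ∀ i j : ι, Integrable (fun U => Af (emb j) U * Af (emb i) (rf U) * wt U) μ)
    (hint1 : ∀ i : ι, Integrable (fun U => Af (emb i) U * wt U) μ)
    (hint1r : ∀ i : ι, Integrable (fun U => Af (emb i) (rf U) * wt U) μ) :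
    (∫ U, (∑ x, coef x * Af x (rf U)) * (∑ x, coef x * Af x U) * wt U ∂μ) / Z -
        (∫ U, (∑ x, coef x * Af x (rf U)) * wt U ∂μ) / Z * ((∫ U, (∑ x, coef x * Af x U) * wt U ∂μ) / Z) =
      ∑ i, ∑ j, cf i * cf j * ((∫ U, Af (emb j) U * Af (emb i) (rf U) * wt U ∂μ) / Z) -
        (∑ i, cf i * ((∫ U, Af (emb i) (rf U) * wt U ∂μ) / Z)) * (∑ j, cf j * ((∫ U, Af (emb j) U * wt U ∂μ) / Z)) := by
  have hr : ∀ U, (∑ x, coef x * Af x (rf U)) = ∑ i, cf i * Af (emb i) (rf U) := fun U => hwin (fun x => Af x (rf U))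
  have hf : ∀ U, (∑ x, coef x * Af x U) = ∑ i, cf i * Af (emb i) U := fun U => hwin (fun x => Af x U)
  simp only [hr, hf]
  rw [MixtureLemmas.integral_bilinear_sum μ cf cf (fun i U => Af (emb i) (rf U)) (fun j U => Af (emb j) U) wt hint2,
    MixtureLemmas.integral_linear_sum μ cf (fun i U => Af (emb i) (rf U)) wt hint1r,
    MixtureLemmas.integral_linear_sum μ cf (fun j U => Af (emb j) U) wt hint1]
  simp only [Finset.sum_div, mul_div_assoc]

end Summit.QuantumFields.YangMills.Theorems.TorusKL.OSData

end
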